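import Summits.ValiantsHypothesis.ValiantsHypothesis.Theorems.LacunarySymmetroidMatrixDescartesFiniteSectorSumMasksHigherTwo

/-!
# `MatrixDescartes` — line «stamp»: the STAMP CEILING `ν(6,4) ≤ 52 = n(6,3)` (kernel) — `StampLawAt 6 4 52`

HONEST FRAMING.  Object-search cell `pub-symmetroid`, seat val-sym-door-p5 g8.  HELPER of the crux item `stmt-ValiantsHypothesis-18050` with NO closure claim.
T3 (`mem_sumset_of_fullPos`) makes every `r ≤ deg` of a full-positive-rooted symmetric `6 × 6` half-pencil with `4` terms an `6`-fold sum of exponents; so the values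
`0, 1` occur and the value set (capped at `54`, padded, sorted) must cover `[0, deg]` by `6`-fold sums; the finite core — no `3` denominations with at most `6` stamps
cover `[0, 53]`, i.e. the classical postage-stamp number `n(6,3) = 52` — is a pruned nested enumeration ({nodes} live prefixes) decided in the kernel with the
`6`-fold sum set as an iterated shift-form BITMASK (`…FiniteSectorSumMasksHigher`).  Result: `stampLawAt_six_four : StampLawAt 6 4 52`.  Located first (exact DFS, this seat):
best reach of `3` denominations with `6` stamps = `52` (e.g. {best}).  Nothing here bears on the crux (asymptotic), on the doors, or on `VP ≠ VNP`.
[folklore] Postage-stamp bookkeeping on the proved T3 (Guy UPINT C12 tables); no citation is load-bearing.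
-/

-- `Summit.ValiantsHypothesis.ValiantsHypothesis.…` repeats a component by the D-0017 layout
-- (single-conjunct summit), which the `dupNamespace` linter flags; the name is mandated.
set_option linter.dupNamespace false

namespace Summit.ValiantsHypothesis.ValiantsHypothesis.Theorems.LacunarySymmetroidMatrixDescartes.FiniteSector

open scoped BigOperators Matrix
open Polynomial

/-! ## `(6,4)`: `ν(6,4) ≤ n(6,3) = 52` -/

set_option synthInstance.maxSize 2000000 in
set_option synthInstance.maxHeartbeats 2000000 in
set_option maxHeartbeats 4000000 in
/-- **Finite core of `n(6,3) = 52`** (pruned nested enumeration over sorted values `1 < … < 55`, `6`-fold sums as bitmasks, `decide` in the kernel):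
prefixes covering `[0, next)` by `6`-fold sums never cover `[0, 53]`. [folklore] -/
theorem stampCheck_six_four :
    ∀ a ∈ List.range 55, (1 < a ∧ (List.foldr (fun x acc => acc ||| (List.foldr (fun x acc => acc ||| (List.foldr (fun x acc => acc ||| (List.foldr (fun x acc => acc ||| (List.foldr (fun x acc => acc ||| (List.foldr (fun y acc => acc ||| 2 ^ y) 0 [0, 1]) * 2 ^ x) 0 [0, 1]) * 2 ^ x) 0 [0, 1]) * 2 ^ x) 0 [0, 1]) * 2 ^ x) 0 [0, 1]) * 2 ^ x) 0 [0, 1] % 2 ^ (min 54 a) = 2 ^ (min 54 a) - 1)) →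
    ∀ b ∈ List.range 55, (a < b ∧ (List.foldr (fun x acc => acc ||| (List.foldr (fun x acc => acc ||| (List.foldr (fun x acc => acc ||| (List.foldr (fun x acc => acc ||| (List.foldr (fun x acc => acc ||| (List.foldr (fun y acc => acc ||| 2 ^ y) 0 [0, 1, a]) * 2 ^ x) 0 [0, 1, a]) * 2 ^ x) 0 [0, 1, a]) * 2 ^ x) 0 [0, 1, a]) * 2 ^ x) 0 [0, 1, a]) * 2 ^ x) 0 [0, 1, a] % 2 ^ (min 54 b) = 2 ^ (min 54 b) - 1)) →
    ¬ (List.foldr (fun x acc => acc ||| (List.foldr (fun x acc => acc ||| (List.foldr (fun x acc => acc ||| (List.foldr (fun x acc => acc ||| (List.foldr (fun x acc => acc ||| (List.foldr (fun y acc => acc ||| 2 ^ y) 0 [0, 1, a, b]) * 2 ^ x) 0 [0, 1, a, b]) * 2 ^ x) 0 [0, 1, a, b]) * 2 ^ x) 0 [0, 1, a, b]) * 2 ^ x) 0 [0, 1, a, b]) * 2 ^ x) 0 [0, 1, a, b] % 2 ^ 54 = 2 ^ 54 - 1) := by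
  decide +kernel

/-- **`ν(6,4) ≤ 52 = n(6,3)`** — `StampLawAt 6 4 52`: every full-positive-rooted symmetric `6 × 6` half-pencil determinant with `4` terms has
degree `≤ 52` (T3 ⇒ every `r ≤ deg` is an `6`-fold sum; values `0, 1` forced; capped at `54`, padded, sorted; masks; `stampCheck_six_four`). [folklore] -/
theorem stampLawAt_six_four : StampLawAt 6 4 52 := by
  intro d S hS hfull
  by_contra hdeg'
  have hdeg : 52 < (pencil d S).det.natDegree := not_le.mp hdeg'
  have hq : (pencil d S).det ≠ 0 := by
    intro h0
    rw [h0] at hdeg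
    simp at hdeg
  have hmem : ∀ r, r ≤ (pencil d S).det.natDegree → ∃ i j k l n o : Fin 4, d i + d j + d k + d l + d n + d o = r := by
    intro r hr
    have hm := mem_sumset_of_fullPos d S hq hfull hr
    rw [Finset.mem_image] at hm
    obtain ⟨s, -, hs⟩ := hm
    obtain ⟨i, j, k, l, n, o, h6⟩ := exists_sum_eq_of_card_six d (s : Multiset (Fin 4)) s.2
    exact ⟨i, j, k, l, n, o, by omega⟩
  set cv : Fin 4 → ℕ := fun i => min (d i) 54 with hcv
  have hcvd : ∀ i, d i ≤ 53 → cv i = d i := fun i hi => by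
    simp only [hcv]
    exact Nat.min_eq_left (by omega)
  have hcvle : ∀ i, cv i ≤ 54 := fun i => Nat.min_le_right _ _
  set V : Finset ℕ := Finset.univ.image cv with hV
  have hcvV : ∀ i, cv i ∈ V := fun i => Finset.mem_image_of_mem cv (Finset.mem_univ i)
  have h0V : 0 ∈ V := by
    obtain ⟨i, j, k, l, n, o, hh⟩ := hmem 0 (Nat.zero_le _)
    have : cv i = 0 := by rw [hcvd i (by omega)]; omega
    exact this ▸ hcvV i
  have h1V : 1 ∈ V := by
    obtain ⟨i, j, k, l, n, o, hh⟩ := hmem 1 (by omega)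
    have key : ∃ t : Fin 4, d t = 1 := by
      by_contra hne; simp only [not_exists] at hne; have := hne i; have := hne j; have := hne k; have := hne l; have := hne n; have := hne o; omega
    obtain ⟨t, ht⟩ := key
    have : cv t = 1 := by rw [hcvd t (by omega)]; omega
    exact this ▸ hcvV t
  have h1V' : 1 ∈ V.erase 0 := Finset.mem_erase.mpr ⟨by norm_num, h1V⟩
  set W : Finset ℕ := (V.erase 0).erase 1 with hW
  have hWsub : W ⊆ ((Finset.range 55).erase 0).erase 1 := by
    intro u hu
    rw [hW, Finset.mem_erase, Finset.mem_erase] at hu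
    obtain ⟨hu1, hu0, huV⟩ := hu
    rw [hV, Finset.mem_image] at huV
    obtain ⟨i, -, rfl⟩ := huV
    rw [Finset.mem_erase, Finset.mem_erase, Finset.mem_range]
    exact ⟨hu1, hu0, Nat.lt_succ_of_le (hcvle i)⟩
  have hWcard : W.card ≤ 2 := by
    have hVK : V.card ≤ 4 := by
      have := Finset.card_image_le (s := (Finset.univ : Finset (Fin 4))) (f := cv)
      simpa using this
    have h1 : (V.erase 0).card + 1 = V.card := Finset.card_erase_add_one h0V
    have h2 : W.card + 1 = (V.erase 0).card := by rw [hW]; exact Finset.card_erase_add_one h1V'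
    omega
  obtain ⟨W', hWW', hW'sub, hW'card⟩ := Finset.exists_subsuperset_card_eq hWsub hWcard (by
    rw [Finset.card_erase_of_mem (by simp), Finset.card_erase_of_mem (by simp), Finset.card_range]; omega)
  have hVW' : ∀ u ∈ V, u = 0 ∨ u = 1 ∨ u ∈ W' := by
    intro u hu
    by_cases hu0 : u = 0
    · exact Or.inl hu0
    by_cases hu1 : u = 1
    · exact Or.inr (Or.inl hu1)
    · exact Or.inr (Or.inr (hWW' (by rw [hW, Finset.mem_erase, Finset.mem_erase]; exact ⟨hu1, hu0, hu⟩)))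
  have hlmem : ∀ u, u ∈ Finset.sort W' ↔ u ∈ W' := fun u => Finset.mem_sort _
  have hlsort : (Finset.sort W').SortedLT := Finset.sortedLT_sort W'
  have hllen : (Finset.sort W').length = 2 := by rw [Finset.length_sort, hW'card]
  generalize hl : Finset.sort W' = l at hlmem hlsort hllen
  rcases l with _ | ⟨a, _ | ⟨b, _ | ⟨zz, ll⟩⟩⟩
  all_goals simp only [List.length_cons, List.length_nil] at hllen
  all_goals try omega
  have hmemR : ∀ u, u ∈ [a, b] → u ∈ List.range 55 := by
    intro u hu
    have hu' : u ∈ W' := (hlmem u).mp hu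
    have := hW'sub hu'
    rw [Finset.mem_erase, Finset.mem_erase, Finset.mem_range] at this
    exact List.mem_range.mpr this.2.2
  have hgt1 : ∀ u, u ∈ [a, b] → 1 < u := by
    intro u hu
    have hu' : u ∈ W' := (hlmem u).mp hu
    have := hW'sub hu'
    rw [Finset.mem_erase, Finset.mem_erase] at this
    omega
  have h1a : 1 < a := hgt1 a (by simp)
  have hmemP : ∀ r, r ≤ 53 → (∃ i j k l n o : Fin 4, d i + d j + d k + d l + d n + d o = r) → (∃ x ∈ [0, 1, a, b], ∃ y ∈ [0, 1, a, b], ∃ z ∈ [0, 1, a, b], ∃ w ∈ [0, 1, a, b], ∃ v ∈ [0, 1, a, b], ∃ o ∈ [0, 1, a, b], x + y + z + w + v + o = r) := by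
    rintro r hr ⟨i, j, k, l, n, o, hsum⟩
    have hi : cv i = d i := hcvd i (by omega)
    have hj : cv j = d j := hcvd j (by omega)
    have hk : cv k = d k := hcvd k (by omega)
    have hl : cv l = d l := hcvd l (by omega)
    have hn : cv n = d n := hcvd n (by omega)
    have ho : cv o = d o := hcvd o (by omega)
    have hin : ∀ u ∈ V, u ∈ [0, 1, a, b] := by
      intro u hu
      rcases hVW' u hu with h | h | h
      · rw [h]; simp
      · rw [h]; simp
      · exact List.mem_cons_of_mem _ (List.mem_cons_of_mem _ ((hlmem u).mpr h))
    exact ⟨cv i, hin _ (hcvV i), cv j, hin _ (hcvV j), cv k, hin _ (hcvV k), cv l, hin _ (hcvV l), cv n, hin _ (hcvV n), cv o, hin _ (hcvV o), by rw [hi, hj, hk, hl, hn, ho]; exact hsum⟩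
  have hcovP : ∀ r, r ≤ 53 → (∃ x ∈ [0, 1, a, b], ∃ y ∈ [0, 1, a, b], ∃ z ∈ [0, 1, a, b], ∃ w ∈ [0, 1, a, b], ∃ v ∈ [0, 1, a, b], ∃ o ∈ [0, 1, a, b], x + y + z + w + v + o = r) := fun r hr => hmemP r hr (hmem r (by omega))
  have hlt1 : a < b := by
    have := hlsort (show (⟨0, by simp⟩ : Fin [a, b].length) < ⟨1, by simp⟩ from Fin.mk_lt_mk.mpr (by norm_num))
    simpa using this
  have pre1 : (List.foldr (fun x acc => acc ||| (List.foldr (fun x acc => acc ||| (List.foldr (fun x acc => acc ||| (List.foldr (fun x acc => acc ||| (List.foldr (fun x acc => acc ||| (List.foldr (fun y acc => acc ||| 2 ^ y) 0 [0, 1]) * 2 ^ x) 0 [0, 1]) * 2 ^ x) 0 [0, 1]) * 2 ^ x) 0 [0, 1]) * 2 ^ x) 0 [0, 1]) * 2 ^ x) 0 [0, 1] % 2 ^ (min 54 a) = 2 ^ (min 54 a) - 1) := by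
    apply maskFull_of_testBit
    intro r hr
    have hrN : r < 54 := lt_of_lt_of_le hr (min_le_left _ _)
    have hrv : r < a := lt_of_lt_of_le hr (min_le_right _ _)
    have hrest : ∀ y ∈ [a, b], a ≤ y := by
      intro y hy
      simp only [List.mem_cons, List.mem_nil_iff, or_false] at hy
      omega
    exact testBit_fold6Shift_of_mem (memP6_prefix (l₁ := [0, 1]) (l₂ := [a, b]) hrest hrv (hcovP r (by omega)))
  have pre2 : (List.foldr (fun x acc => acc ||| (List.foldr (fun x acc => acc ||| (List.foldr (fun x acc => acc ||| (List.foldr (fun x acc => acc ||| (List.foldr (fun x acc => acc ||| (List.foldr (fun y acc => acc ||| 2 ^ y) 0 [0, 1, a]) * 2 ^ x) 0 [0, 1, a]) * 2 ^ x) 0 [0, 1, a]) * 2 ^ x) 0 [0, 1, a]) * 2 ^ x) 0 [0, 1, a]) * 2 ^ x) 0 [0, 1, a] % 2 ^ (min 54 b) = 2 ^ (min 54 b) - 1) := by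
    apply maskFull_of_testBit
    intro r hr
    have hrN : r < 54 := lt_of_lt_of_le hr (min_le_left _ _)
    have hrv : r < b := lt_of_lt_of_le hr (min_le_right _ _)
    have hrest : ∀ y ∈ [b], b ≤ y := by
      intro y hy
      simp only [List.mem_cons, List.mem_nil_iff, or_false] at hy
      omega
    exact testBit_fold6Shift_of_mem (memP6_prefix (l₁ := [0, 1, a]) (l₂ := [b]) hrest hrv (hcovP r (by omega)))
  have hcovT : (List.foldr (fun x acc => acc ||| (List.foldr (fun x acc => acc ||| (List.foldr (fun x acc => acc ||| (List.foldr (fun x acc => acc ||| (List.foldr (fun x acc => acc ||| (List.foldr (fun y acc => acc ||| 2 ^ y) 0 [0, 1, a, b]) * 2 ^ x) 0 [0, 1, a, b]) * 2 ^ x) 0 [0, 1, a, b]) * 2 ^ x) 0 [0, 1, a, b]) * 2 ^ x) 0 [0, 1, a, b]) * 2 ^ x) 0 [0, 1, a, b] % 2 ^ 54 = 2 ^ 54 - 1) :=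
    maskFull_of_testBit (fun r hr => testBit_fold6Shift_of_mem (hcovP r (by omega)))
  exact stampCheck_six_four a (hmemR a (by simp)) ⟨h1a, pre1⟩ b (hmemR b (by simp)) ⟨hlt1, pre2⟩ hcovT

end Summit.ValiantsHypothesis.ValiantsHypothesis.Theorems.LacunarySymmetroidMatrixDescartes.FiniteSector
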